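import Summits.Ventures.YMGap.RobustBall.MassGapOnBallMassive
import Summits.Ventures.YMGap.RobustBall.RowsSUN
import Summits.Ventures.YMGap.RobustBall.RowsDim3
import Summits.Ventures.YMGap.RobustBall.AdjointWitness
import HarnessLib

/-!
# Venture YMGap, track ROBUST-BALL — MASSIVE ROWS ON THE `ℤ^d` BALL: every `N ≥ 2` (Bakry–Émery, hypothesis-free),
# `SU(3)` on the cell's certificates, every `d` (Osterwalder–Seiler clause), `d = 3` rows of record, and the
# named mixed fundamental–adjoint `SU(2)` action — all read through «mass gap on the ball ⇒ every DLR state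
# of every member is massive»

HONEST FRAMING. WHAT THIS IS: a venture file (cell `pub-ymgap`, track Y2 ROBUST-BALL, seat ds-3),
strong-coupling LATTICE statements for `SU(N)` lattice Yang–Mills on `ℤ⁴` with a PERTURBED action
`N β S_W + W`, `(W, supp)` in rb-p1's tier-1 ball `MemBallZd ε₀ ε₁ R`. Kernel COMPOSITION only: the
conversion `massive_onBallZd_of_massGapOnBallZd` (`MassGapOnBallMassive.lean`) applied to
(i) p2's HYPOTHESIS-FREE all-`N` Bakry–Émery ball rows (`RowsSUN.lean`:
`suN_massGapOnBallZd_bakryEmery_dim4`, numeric row `(β, ε₀, ε₁) = (1/64, 1/10, 1/10)` for every `N ≥ 2`), and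
(ii) engine-2's `SU(3)` ball rows on the cell's CERTIFIED one-link pair (`RowsSU3Certified.lean`, rows
K-conditional on the two displayed finite-dimensional hypotheses H1 `OneLinkPoincareSUN 3 (3/5) (4/5)`,
H2 `OneLinkVarianceBound 3 (11/30) (49/20)` — nothing is asserted about H1/H2 here). RESULT: for every
`N ≥ 2`, every member of the ball at the listed radii has DLR states and ALL of them are MASSIVE
(`IsMassiveState`) with exponentially decaying plaquette–plaquette correlation function — the «every `N`»
line of the Y2 table in the massive-state currency; `SU(3)` rows at Wilson `β_W = 1/8, 1/4, 1/3` likewise,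
given H1/H2; and (iii) the EVERY-`d` form of the conversion (`massiveClause_onBallZd`: `MassGapOnBallZd d N β ε₀ ε₁ R`
⇒ for every member and every DLR state the Osterwalder–Seiler clause — one rate for all truncated correlations of
bounded measurable local observables — i.e. the body of `IsMassiveState` with `4 ↦ d`), with rb-p1's every-`d`
hypothesis-free `SU(2)` ball theorem read through it (`su2_massiveClause_onBallZd`:
`2(d−1)|β_W| e^{ε₀} + e^{ε₀/2} √(2/3) ε₁ < 1`) and engine-2's `d = 3` rows of record (`RowsDim3.lean`, the receiving end
named by track Y4) as `d = 3` massive-clause rows (`su2_dim3_massiveClause_row_1_8 / _1_4`); and (iv) the NAMED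
MIXED-ACTION ROW of the Y2 table (HEADLINE row 5; rb-p1's `su2_mixedAction_massGap_1_8` at the T0.2 witness
`adjointWitness t`, `AdjointWitness.lean`) in the massive-state currency: the `SU(2)` Wilson action at `β_W = 1/8`
plus the adjoint term `t Σ_p (Re tr U_p/2)²`, `|t| ≤ 1/100`, has DLR states on `ℤ⁴`, EVERY one MASSIVE with
plaquette–plaquette decay (`su2_mixedAction_massive_1_8`, hypothesis-free). WHAT IT IS NOT: no new `(β⋆, ε)` number (p2's / engine-2's rows verbatim), no certificate,
no star/slab door; nothing about the continuum, confinement, a transfer-matrix gap or the Clay problem.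

References: H. Shen, R. Zhu, X. Zhu, CMP 400 (2023) 805–851 (Bakry–Émery one-link inputs, Cor. 1.6);
K. Osterwalder, E. Seiler, Ann. Phys. 110 (1978) 440, §4; rb-theory `HOME/rb/K1-STATUS.md` («N ≥ 3 rows
on the ball: to-do»), `HEADLINE-CANDIDATES.md`.
-/

noncomputable section

open MeasureTheory ProbabilityTheory Function Finset Filter Topology
open scoped NNReal
open Literature.Probability.LatticeModels
open Literature.MathematicalPhysics.QuantumLattice
open Literature.MathematicalPhysics.QuantumFieldTheory hiding ZdEdge
open Literature.Barriers.QuantumFields (IsMassiveState)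
open Summit.QuantumFields.BalabanUV.InfraRed.StrongCouplingPoincareDoorSUN (OneLinkPoincareSUN)
open Summit.QuantumFields.BalabanUV.InfraRed.StrongCouplingVarianceDoorSUN (OneLinkVarianceBound)
open Summit.Ventures.YMGap.RobustBallSUN (suN_massGapOnBallZd_bakryEmery_dim4
  suN_massGapOnBallZd_bakryEmery_dim4_row)
open Summit.Ventures.YMGap.RobustBallSU3 (su3_row_1_8 su3_row_1_4 su3_row_1_3)
open Summit.Ventures.YMGap.RobustBallDim3 (su2_dim3_row_1_8 su2_dim3_row_1_4)

namespace Summit.Ventures.YMGap.RobustBall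

variable {d N : ℕ}

/-! ### Packaging at a fixed member: `PerturbedMassGapAt` ⇒ DLR states exist and all are massive -/

/-- **A member row is a massive-member row**: `PerturbedMassGapAt 4 N β W supp` at a member `(W, supp)` of some
`MemBallZd ε₀ ε₁ R` (any `N ≥ 1`) gives: DLR states exist and every DLR state is massive with exponentially
decaying plaquette–plaquette correlation function. -/
theorem massive_of_perturbedMassGapAt (hN : 1 ≤ N) {β ε₀ ε₁ R : ℝ}
    {W : Potential (ZdEdge 4) (Matrix.specialUnitaryGroup (Fin N) ℂ)}
    {supp : Finset (ZdEdge 4) → Finset (Finset (ZdEdge 4))} (hmem : MemBallZd ε₀ ε₁ R W supp)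
    (h : PerturbedMassGapAt 4 N β W supp) :
    (perturbedGibbsMeasures (d := 4) (fundamentalRep (Fin N)) ((N : ℝ) * β) W supp).Nonempty ∧
      ∀ μ ∈ perturbedGibbsMeasures (d := 4) (fundamentalRep (Fin N)) ((N : ℝ) * β) W supp,
        IsMassiveState μ ∧ HasExponentialDecay (plaquetteCorrFn (fundamentalRep (Fin N)) μ) := by
  haveI : SecondCountableTopology (Matrix (Fin N) (Fin N) ℂ) :=
    inferInstanceAs (SecondCountableTopology (Fin N → Fin N → ℂ))
  haveI : SecondCountableTopology (Matrix.specialUnitaryGroup (Fin N) ℂ) :=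
    Topology.IsEmbedding.subtypeVal.secondCountableTopology
  exact ⟨perturbedGibbsMeasures_nonempty _ (continuous_fundamentalRep (Fin N)) _ hmem.continuous
      hmem.dependsOn hmem.supportedBy,
    fun μ hμ => ⟨isMassiveState_of_perturbedMassGapAt hN hmem h μ hμ,
      hasExponentialDecay_plaquetteCorrFn_of_perturbedMassGapAt hN hmem h μ hμ⟩⟩

/-! ### The named mixed fundamental–adjoint `SU(2)` action (HEADLINE row 5) is massive -/

/-- ★★ **THE MIXED FUNDAMENTAL–ADJOINT `SU(2)` ACTION AT `β_W = 1/8`, `|t| ≤ 1/100` ON `ℤ⁴`: DLR STATES EXIST AND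
EVERY ONE IS MASSIVE, HYPOTHESIS-FREE** — the Wilson action at `β_W = 1/8` ('t Hooft `1/32`, tree coupling
`1/16`) plus the adjoint term `t Σ_p (Re tr U_p/2)²` (rb-p1's T0.2 witness `adjointWitness t`, a member of
`MemBallZd (6|t|) (48|t|/√2) 1` by `memBallZd_adjointWitness`), read through rb-p1's certified row
`su2_mixedAction_massGap_1_8` and the conversion of this chain: every DLR state is a MASSIVE STATE (one rate for
all truncated correlations of bounded measurable local observables) with exponentially decaying plaquette–plaquette
correlation function. A concrete NON-Wilson lattice gauge action with a kernel-certified massive phase point. -/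
theorem su2_mixedAction_massive_1_8 {t : ℝ} (ht : |t| ≤ 1 / 100) :
    (perturbedGibbsMeasures (d := 4) (fundamentalRep (Fin 2)) (((2 : ℕ) : ℝ) * ((1 / 8 : ℝ) / 4))
        (adjointWitness t) plaquetteSupp).Nonempty ∧
      ∀ μ ∈ perturbedGibbsMeasures (d := 4) (fundamentalRep (Fin 2)) (((2 : ℕ) : ℝ) * ((1 / 8 : ℝ) / 4))
          (adjointWitness t) plaquetteSupp,
        IsMassiveState μ ∧ HasExponentialDecay (plaquetteCorrFn (fundamentalRep (Fin 2)) μ) :=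
  massive_of_perturbedMassGapAt (by norm_num)
    (memBallZd_adjointWitness (d := 4) (N := 2) (by norm_num) (by norm_num) t) (su2_mixedAction_massGap_1_8 ht)

/-- **Tree-coupling reading** (`(2:ℕ)·((1/8)/4) = 1/16`): every DLR state of
`perturbedYM (fundamentalRep (Fin 2)) (1/16) (adjointWitness t) plaquetteSupp`, `|t| ≤ 1/100`, is massive with
plaquette–plaquette decay. -/
theorem su2_mixedAction_massive_1_8_tree {t : ℝ} (ht : |t| ≤ 1 / 100) :
    ∀ μ ∈ perturbedGibbsMeasures (d := 4) (fundamentalRep (Fin 2)) (1 / 16) (adjointWitness t) plaquetteSupp,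
      IsMassiveState μ ∧ HasExponentialDecay (plaquetteCorrFn (fundamentalRep (Fin 2)) μ) := by
  have e : (((2 : ℕ) : ℝ) * ((1 / 8 : ℝ) / 4)) = 1 / 16 := by push_cast; ring
  rw [← e]
  exact (su2_mixedAction_massive_1_8 ht).2

/-! ### Every `N ≥ 2`: the Bakry–Émery massive rows on the ball (hypothesis-free) -/

/-- ★★ **EVERY `N ≥ 2`: EVERY DLR STATE OF EVERY MEMBER OF THE BAKRY–ÉMERY BALL IS MASSIVE,
HYPOTHESIS-FREE** (`d = 4`, 't Hooft `β`, tree coupling `N β`): for `6|β| < 1/2` and radii with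
`18|β| e^{ε₀}/(1/2 − 6|β|) + e^{ε₀/2} ε₁/√(N(1/2 − 6|β|)) < 1` (p2's all-`N` pair door fed with the tree's
Bakry–Émery one-link constants), every member `(W, supp)` of `MemBallZd ε₀ ε₁ R` added to `N β S_W` has DLR
states and every one of them is a MASSIVE STATE with exponentially decaying plaquette–plaquette correlation
function. At `ε₀ = ε₁ = 0`: the Shen–Zhu–Zhu window `|β| < 1/48`, now in the massive-state currency for
every `N`. -/
theorem suN_massive_onBallZd_bakryEmery_dim4 (hN : 2 ≤ N) {β ε₀ ε₁ : ℝ} (R : ℝ) (hb : 6 * |β| < 1 / 2)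
    (hρ : 18 * |β| * Real.exp ε₀ / (1 / 2 - 6 * |β|) +
      Real.exp (ε₀ / 2) * ε₁ / Real.sqrt ((N : ℝ) * (1 / 2 - 6 * |β|)) < 1)
    {W : Potential (ZdEdge 4) (Matrix.specialUnitaryGroup (Fin N) ℂ)}
    {supp : Finset (ZdEdge 4) → Finset (Finset (ZdEdge 4))} (hmem : MemBallZd ε₀ ε₁ R W supp) :
    (perturbedGibbsMeasures (d := 4) (fundamentalRep (Fin N)) ((N : ℝ) * β) W supp).Nonempty ∧
      ∀ μ ∈ perturbedGibbsMeasures (d := 4) (fundamentalRep (Fin N)) ((N : ℝ) * β) W supp,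
        IsMassiveState μ ∧ HasExponentialDecay (plaquetteCorrFn (fundamentalRep (Fin N)) μ) :=
  massive_onBallZd_of_massGapOnBallZd (le_trans (by norm_num) hN)
    (suN_massGapOnBallZd_bakryEmery_dim4 hN R hb hρ) hmem

/-- **The numeric all-`N` massive row** (`d = 4`; p2's `suN_massGapOnBallZd_bakryEmery_dim4_row`): for
EVERY `N ≥ 2`, every member of `MemBallZd (1/10) (1/10) R` added to `SU(N)` Wilson at 't Hooft `β = 1/64`
(three quarters of the Shen–Zhu–Zhu window) has DLR states, all massive with plaquette–plaquette decay. -/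
theorem suN_massive_onBallZd_row (hN : 2 ≤ N) (R : ℝ)
    {W : Potential (ZdEdge 4) (Matrix.specialUnitaryGroup (Fin N) ℂ)}
    {supp : Finset (ZdEdge 4) → Finset (Finset (ZdEdge 4))}
    (hmem : MemBallZd (1 / 10) (1 / 10) R W supp) :
    (perturbedGibbsMeasures (d := 4) (fundamentalRep (Fin N)) ((N : ℝ) * (1 / 64)) W supp).Nonempty ∧
      ∀ μ ∈ perturbedGibbsMeasures (d := 4) (fundamentalRep (Fin N)) ((N : ℝ) * (1 / 64)) W supp,
        IsMassiveState μ ∧ HasExponentialDecay (plaquetteCorrFn (fundamentalRep (Fin N)) μ) :=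
  massive_onBallZd_of_massGapOnBallZd (le_trans (by norm_num) hN)
    (suN_massGapOnBallZd_bakryEmery_dim4_row hN R) hmem

/-! ### `SU(3)` on the cell's certified one-link pair (rows K-conditional on H1/H2, displayed) -/

/-- **`SU(3)` massive ball row `(β⋆_W, ε) = (1/8, 0.299)` GIVEN the cell's certificates H1/H2**
(engine-2's `RobustBallSU3.su3_row_1_8`; Wilson `β_W = 1/8`, 't Hooft `β_W/9`, tree coupling `3·(β_W/9)`;
convention `ε₀ = 2ε`, `ε₁ = ε`): every member of `MemBallZd 0.598 0.299 R` added to `SU(3)` Wilson at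
`β_W = 1/8` has DLR states, all massive with plaquette–plaquette decay. Nothing is asserted about H1/H2. -/
theorem su3_massive_row_1_8 (R : ℝ) (hP : OneLinkPoincareSUN 3 (3 / 5) (4 / 5))
    (hV : OneLinkVarianceBound 3 (11 / 30) (49 / 20))
    {W : Potential (ZdEdge 4) (Matrix.specialUnitaryGroup (Fin 3) ℂ)}
    {supp : Finset (ZdEdge 4) → Finset (Finset (ZdEdge 4))}
    (hmem : MemBallZd (2 * (299 / 1000)) (299 / 1000) R W supp) :
    (perturbedGibbsMeasures (d := 4) (fundamentalRep (Fin 3)) (((3 : ℕ) : ℝ) * ((1 / 8 : ℝ) / 9)) W supp).Nonempty ∧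
      ∀ μ ∈ perturbedGibbsMeasures (d := 4) (fundamentalRep (Fin 3)) (((3 : ℕ) : ℝ) * ((1 / 8 : ℝ) / 9)) W supp,
        IsMassiveState μ ∧ HasExponentialDecay (plaquetteCorrFn (fundamentalRep (Fin 3)) μ) :=
  massive_onBallZd_of_massGapOnBallZd (by norm_num) (su3_row_1_8 R hP hV) hmem

/-- **`SU(3)` massive ball row `(β⋆_W, ε) = (1/4, 0.116)` GIVEN H1/H2** (engine-2's `su3_row_1_4`). -/
theorem su3_massive_row_1_4 (R : ℝ) (hP : OneLinkPoincareSUN 3 (3 / 5) (4 / 5))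
    (hV : OneLinkVarianceBound 3 (11 / 30) (49 / 20))
    {W : Potential (ZdEdge 4) (Matrix.specialUnitaryGroup (Fin 3) ℂ)}
    {supp : Finset (ZdEdge 4) → Finset (Finset (ZdEdge 4))}
    (hmem : MemBallZd (2 * (29 / 250)) (29 / 250) R W supp) :
    (perturbedGibbsMeasures (d := 4) (fundamentalRep (Fin 3)) (((3 : ℕ) : ℝ) * ((1 / 4 : ℝ) / 9)) W supp).Nonempty ∧
      ∀ μ ∈ perturbedGibbsMeasures (d := 4) (fundamentalRep (Fin 3)) (((3 : ℕ) : ℝ) * ((1 / 4 : ℝ) / 9)) W supp,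
        IsMassiveState μ ∧ HasExponentialDecay (plaquetteCorrFn (fundamentalRep (Fin 3)) μ) :=
  massive_onBallZd_of_massGapOnBallZd (by norm_num) (su3_row_1_4 R hP hV) hmem

/-- **`SU(3)` massive ball row `(β⋆_W, ε) = (1/3, 0.023)` GIVEN H1/H2** (engine-2's `su3_row_1_3`; the
largest Wilson coupling of engine-2's table, `β_W = 1/3` of the single-link door's `5/14` threshold). -/
theorem su3_massive_row_1_3 (R : ℝ) (hP : OneLinkPoincareSUN 3 (3 / 5) (4 / 5))
    (hV : OneLinkVarianceBound 3 (11 / 30) (49 / 20))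
    {W : Potential (ZdEdge 4) (Matrix.specialUnitaryGroup (Fin 3) ℂ)}
    {supp : Finset (ZdEdge 4) → Finset (Finset (ZdEdge 4))}
    (hmem : MemBallZd (2 * (23 / 1000)) (23 / 1000) R W supp) :
    (perturbedGibbsMeasures (d := 4) (fundamentalRep (Fin 3)) (((3 : ℕ) : ℝ) * ((1 / 3 : ℝ) / 9)) W supp).Nonempty ∧
      ∀ μ ∈ perturbedGibbsMeasures (d := 4) (fundamentalRep (Fin 3)) (((3 : ℕ) : ℝ) * ((1 / 3 : ℝ) / 9)) W supp,
        IsMassiveState μ ∧ HasExponentialDecay (plaquetteCorrFn (fundamentalRep (Fin 3)) μ) :=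
  massive_onBallZd_of_massGapOnBallZd (by norm_num) (su3_row_1_3 R hP hV) hmem

/-- **`SU(3)` Wilson-coupling reading of the `1/8` row** (tree coupling `β_W/3 = 1/24`): given H1/H2, every
DLR state of `perturbedYM (fundamentalRep (Fin 3)) (1/24) W supp`, `(W, supp) ∈ MemBallZd 0.598 0.299 R`, is
massive with plaquette–plaquette decay. -/
theorem su3_massive_row_1_8_wilson (R : ℝ) (hP : OneLinkPoincareSUN 3 (3 / 5) (4 / 5))
    (hV : OneLinkVarianceBound 3 (11 / 30) (49 / 20))
    {W : Potential (ZdEdge 4) (Matrix.specialUnitaryGroup (Fin 3) ℂ)}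
    {supp : Finset (ZdEdge 4) → Finset (Finset (ZdEdge 4))}
    (hmem : MemBallZd (2 * (299 / 1000)) (299 / 1000) R W supp) :
    ∀ μ ∈ perturbedGibbsMeasures (d := 4) (fundamentalRep (Fin 3)) (1 / 24) W supp,
      IsMassiveState μ ∧ HasExponentialDecay (plaquetteCorrFn (fundamentalRep (Fin 3)) μ) := by
  have e : (((3 : ℕ) : ℝ) * ((1 / 8 : ℝ) / 9)) = 1 / 24 := by push_cast; ring
  rw [← e]
  exact (su3_massive_row_1_8 R hP hV hmem).2

/-! ### Every dimension `d ≥ 1`: the Osterwalder–Seiler clause on the ball -/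

/-- **EVERY `d ≥ 1`: MASS GAP ON THE BALL ⇒ THE OSTERWALDER–SEILER CLAUSE FOR EVERY DLR STATE OF EVERY
MEMBER** (`SU(N)`, `N ≥ 1`, 't Hooft `β`, tree coupling `N β`): under rb-p1's `MassGapOnBallZd d N β ε₀ ε₁ R`,
every DLR state `μ` of every member `(W, supp) ∈ MemBallZd ε₀ ε₁ R` has ONE rate `m > 0` at which
`cov_μ(F₁, F₂ ∘ θ_x)` decays exponentially for ALL bounded measurable local observables `F₁, F₂` — the body of
`IsMassiveState` with `4 ↦ d` (gauge-invariance binders dropped: stronger). -/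
theorem massiveClause_onBallZd (hd : 1 ≤ d) (hN : 1 ≤ N) {β ε₀ ε₁ R : ℝ} (h : MassGapOnBallZd d N β ε₀ ε₁ R)
    {W : Potential (ZdEdge d) (Matrix.specialUnitaryGroup (Fin N) ℂ)}
    {supp : Finset (ZdEdge d) → Finset (Finset (ZdEdge d))} (hmem : MemBallZd ε₀ ε₁ R W supp) :
    ∀ μ ∈ perturbedGibbsMeasures (d := d) (fundamentalRep (Fin N)) ((N : ℝ) * β) W supp,
      ∃ m : ℝ, ∀ F₁ F₂ : LGConfig d (Matrix.specialUnitaryGroup (Fin N) ℂ) → ℝ,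
        Literature.MathematicalPhysics.QuantumLattice.IsLocalObservable F₁ →
        Literature.MathematicalPhysics.QuantumLattice.IsLocalObservable F₂ →
        Measurable F₁ → Measurable F₂ → (∃ C, ∀ U, |F₁ U| ≤ C) → (∃ C, ∀ U, |F₂ U| ≤ C) →
          HasExponentialDecayRate
            (fun x : Site d => cov[F₁, fun U => F₂ (Literature.MathematicalPhysics.QuantumLattice.configShift x U); μ]) m := by
  intro μ hμ
  obtain ⟨c, hc, hcl⟩ := (h W supp hmem).2 μ hμ
  refine ⟨c, fun F₁ F₂ h₁ h₂ h₁m h₂m hb₁ hb₂ => ?_⟩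
  obtain ⟨C, hC⟩ := perturbed_covariance_decay_of_memBallZd hd hN ((N : ℝ) * β) hmem hμ hc hcl F₁ F₂ h₁ h₂
    h₁m h₂m hb₁ hb₂
  exact ⟨hc, C, hC⟩

/-- ★ **EVERY `d ≥ 1`, `SU(2)`, HYPOTHESIS-FREE: the Osterwalder–Seiler clause on the ball** (Wilson units,
't Hooft `β_W/4`, tree coupling `(2:ℕ)·(β_W/4) = β_W/2`): for `2(d−1)|β_W| e^{ε₀} + e^{ε₀/2} √(2/3) ε₁ < 1`
(rb-p1's `su2_massGapOnBallZd`; `d = 4`: `6|β_W| e^{ε₀} + …`; `d = 3`: `4|β_W| e^{ε₀} + …`), every DLR state of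
every member of `MemBallZd ε₀ ε₁ R` added to `SU(2)` Wilson at `β_W` on `ℤ^d` clusters exponentially, with one
rate, for all bounded measurable local observables. -/
theorem su2_massiveClause_onBallZd (hd : 1 ≤ d) {βW ε₀ ε₁ : ℝ} (R : ℝ)
    (hρ : 2 * ((d : ℝ) - 1) * |βW| * Real.exp ε₀ + Real.exp (ε₀ / 2) * Real.sqrt (2 / 3) * ε₁ < 1)
    {W : Potential (ZdEdge d) (Matrix.specialUnitaryGroup (Fin 2) ℂ)}
    {supp : Finset (ZdEdge d) → Finset (Finset (ZdEdge d))} (hmem : MemBallZd ε₀ ε₁ R W supp) :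
    ∀ μ ∈ perturbedGibbsMeasures (d := d) (fundamentalRep (Fin 2)) (((2 : ℕ) : ℝ) * (βW / 4)) W supp,
      ∃ m : ℝ, ∀ F₁ F₂ : LGConfig d (Matrix.specialUnitaryGroup (Fin 2) ℂ) → ℝ,
        Literature.MathematicalPhysics.QuantumLattice.IsLocalObservable F₁ →
        Literature.MathematicalPhysics.QuantumLattice.IsLocalObservable F₂ →
        Measurable F₁ → Measurable F₂ → (∃ C, ∀ U, |F₁ U| ≤ C) → (∃ C, ∀ U, |F₂ U| ≤ C) →
          HasExponentialDecayRate
            (fun x : Site d => cov[F₁, fun U => F₂ (Literature.MathematicalPhysics.QuantumLattice.configShift x U); μ]) m :=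
  massiveClause_onBallZd hd (by norm_num) (su2_massGapOnBallZd hd R hρ) hmem

/-- **`d = 3` row of record as a massive-clause row, `SU(2)`, HYPOTHESIS-FREE** (engine-2's
`RobustBallDim3.su2_dim3_row_1_8`: `(β⋆_W, ε) = (1/8, 0.258)`, tree coupling `(2:ℕ)·((1/8)/4) = 1/16`): every DLR
state of every member of `MemBallZd 0.516 0.258 R` added to `SU(2)` Wilson at `β_W = 1/8` on `ℤ³` clusters
exponentially, with one rate, for all bounded measurable local observables. -/
theorem su2_dim3_massiveClause_row_1_8 (R : ℝ)
    {W : Potential (ZdEdge 3) (Matrix.specialUnitaryGroup (Fin 2) ℂ)}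
    {supp : Finset (ZdEdge 3) → Finset (Finset (ZdEdge 3))}
    (hmem : MemBallZd (2 * (129 / 500)) (129 / 500) R W supp) :
    ∀ μ ∈ perturbedGibbsMeasures (d := 3) (fundamentalRep (Fin 2)) (((2 : ℕ) : ℝ) * ((1 / 8 : ℝ) / 4)) W supp,
      ∃ m : ℝ, ∀ F₁ F₂ : LGConfig 3 (Matrix.specialUnitaryGroup (Fin 2) ℂ) → ℝ,
        Literature.MathematicalPhysics.QuantumLattice.IsLocalObservable F₁ →
        Literature.MathematicalPhysics.QuantumLattice.IsLocalObservable F₂ →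
        Measurable F₁ → Measurable F₂ → (∃ C, ∀ U, |F₁ U| ≤ C) → (∃ C, ∀ U, |F₂ U| ≤ C) →
          HasExponentialDecayRate
            (fun x : Site 3 => cov[F₁, fun U => F₂ (Literature.MathematicalPhysics.QuantumLattice.configShift x U); μ]) m :=
  massiveClause_onBallZd (by norm_num) (by norm_num) (su2_dim3_row_1_8 R) hmem

/-- **`d = 3`, largest coupling of engine-2's `SU(2)` table: `(β⋆_W, ε) = (1/4, 0.049)` as a massive-clause row**
(`RobustBallDim3.su2_dim3_row_1_4`). -/
theorem su2_dim3_massiveClause_row_1_4 (R : ℝ)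
    {W : Potential (ZdEdge 3) (Matrix.specialUnitaryGroup (Fin 2) ℂ)}
    {supp : Finset (ZdEdge 3) → Finset (Finset (ZdEdge 3))}
    (hmem : MemBallZd (2 * (49 / 1000)) (49 / 1000) R W supp) :
    ∀ μ ∈ perturbedGibbsMeasures (d := 3) (fundamentalRep (Fin 2)) (((2 : ℕ) : ℝ) * ((1 / 4 : ℝ) / 4)) W supp,
      ∃ m : ℝ, ∀ F₁ F₂ : LGConfig 3 (Matrix.specialUnitaryGroup (Fin 2) ℂ) → ℝ,
        Literature.MathematicalPhysics.QuantumLattice.IsLocalObservable F₁ →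
        Literature.MathematicalPhysics.QuantumLattice.IsLocalObservable F₂ →
        Measurable F₁ → Measurable F₂ → (∃ C, ∀ U, |F₁ U| ≤ C) → (∃ C, ∀ U, |F₂ U| ≤ C) →
          HasExponentialDecayRate
            (fun x : Site 3 => cov[F₁, fun U => F₂ (Literature.MathematicalPhysics.QuantumLattice.configShift x U); μ]) m :=
  massiveClause_onBallZd (by norm_num) (by norm_num) (su2_dim3_row_1_4 R) hmem

end Summit.Ventures.YMGap.RobustBall

end
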